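import Summits.QuantumFields.YangMills.Theorems.BalabanUVNodesN18AdmTransportPlaqSmall
import Summits.QuantumFields.YangMills.Theorems.BalabanUVNodesN18HLayerW1Induction

/-!
# BalabanUVNodes ∕ node N18 = NE5 — THE s1 ∘ s2 JUNCTION AT THE ADMISSIBLE READING IN THE PRINT's INDUCTIVE CURRENCY: the END run on the admissible
# pairing's carriers with its levels leaves L05 ∕ L06 PRODUCED from dag-n18-c g4's ONE-STEP SCHEMA (STEP) — [I] Thm 1's induction hypotheses (1.18) +
# analyticity at the levels `≤ m` ⟹ the step-`m` H-layer pair — instead of unconditional per-step `AnalyticH` ∕ `Bound238` (Track A, DAG node N18 =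
# `T4OutputRate.NE5` :211; cluster K4 «SpineRates», item K3′ `SpineGivenEndpointR12`; module 14 of seat pub-ymgap-dag-n18-d, strategy s2)

HONEST FRAMING.  Count-neutral kernel bookkeeping (`--supports stmt-QuantumFields-19908 --as helper`), composition BY NAME of landed theorems; NE5 is NOT
PRINTED and NOT proved; N18 is NOT discharged; no inhabitant of `IsDatumOfRecord₁₂C` is claimed (K0′).

WHY.  Modules 11–13 feed the END's levels leaves L05 ∕ L06 ([I] (1.18) for the two runs' (2.13) terms) from the towers' H-layer data `AnalyticH` + `Bound238` asked
UNCONDITIONALLY at every step.  dag-n18-c g4's `…N18HLayerW1Induction` (p484975) types the print's form instead: the ONE-STEP SCHEMA (STEP) — for every step `m`,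
(1.18) with letters `(E₀, r₁)` and [I] p. 263 analyticity ON THE TABLES at all levels `j ≤ m` IMPLY the step-`m` pair `(S m).AnalyticH ∧ (S m).Bound238` ([II]
pp. 15–22 for the terms of record, DISPLAYED) — and runs Theorem 1's strong induction in the kernel, delivering L05 ∕ L06 AT THE ADMISSIBLE PAIRING with no
embedding ∕ pairing clause (`decayBound_EA∕EB_ofRecordAdm_of_inductiveStep`, amplitude renewal `e·576·K₀(64,8)²·A ≤ E₀`).  This file plugs those producers into
the END (module 9 `n18At_pairing_of_envelopeOnW1Carriers`) at the admissible reading and at the plaquette-small tables of module 13.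

WHAT.
* §1 `n18At_pairingAdm_of_inductiveStep` — `N18At` at the admissible pairing of record from the END's data over its carriers + (STEP) for both runs' towers on the
  tables `sp k` ∕ `sp (k+1)` (+ restriction-closedness, the located rate clause, the STRICT [KP86] clauses, the renewals).
* §2 `s_N18_readingAdm₁₂_of_inductiveStep` — THE ROW AT THE ADMISSIBLE READING in the inductive currency ⇒ `S_N18 (RRec₁₂ 𝔯_adm)`.
* §3 `s_N18_readingAdmPlaqSmall₁₂_of_inductiveStep` — the same ON THE PLAQUETTE-SMALL TABLES with the transport of record (restriction clauses trivial, transport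
  clause any proof — module 13 §4's `admTransport_plaqSmall(_sharp)`).
What REMAINS displayed: the END's data-direction datum and leaves (NODE O ∕ rows NE2–NE3), (STEP) for the towers of record ([II] Lemmas 1–3 ∕ NODE A, per step,
GIVEN the inductive assumptions — the print's exact residual), the towers `S` (node00-def-W1 g4), the table family ∕ thresholds, K0′.  One finite four-torus programme
at fixed `ε`; NOT the continuum limit, NOT OS, NOT a mass gap, NOT Clay.  0 `def`, 0 `sorry`.  Sources (TYPES only): T. Bałaban, CMP **109** (1987) [Balaban1987RG1]
(0.18) p. 255, (0.24)–(0.25) p. 257, Thm 1 p. 259, (1.18) and the analyticity sentence p. 263; CMP **116** (1988) [Balaban1988RG2Cluster] (2.13) p. 14, p. 15,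
(2.16)–(2.18) p. 16, Lemma 3 (2.38) p. 20, (2.41) p. 21, p. 22; CMP **98** (1985) [Balaban1985Averaging] Prop. 1 (51) p. 26; R. Kotecký–D. Preiss, CMP **103** (1986)
[KoteckyPreiss1986] Thm 1 p. 492.
-/

noncomputable section

open Set Metric
open scoped Matrix.Norms.L2Operator

namespace YMDAG.N18.W1Reading

open Literature.MathematicalPhysics.QuantumFieldTheory.Balaban1983to89
open Literature.MathematicalPhysics.QuantumFieldTheory.Balaban1983to89.T4Continuum
open Literature.MathematicalPhysics.QuantumFieldTheory.Balaban1983to89.T4OutputRate (Carriers Functional NE5 DecayBound Window)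
open Literature.MathematicalPhysics.QuantumFieldTheory.Balaban1983to89.T4InputCauchyRateData (StepModel)
open Literature.MathematicalPhysics.QuantumFieldTheory.Balaban1983to89.B13Resummation (locE)
open Literature.MathematicalPhysics.QuantumFieldTheory.Balaban1983to89.TreeLengthTorus (TDom tsys torusTreeLen)
open Literature.MathematicalPhysics.QuantumFieldTheory.Balaban1983to89.TreeLengthTorusGeometry (TTouch)
open Literature.MathematicalPhysics.QuantumFieldTheory.Balaban1983to89.B12TreeDecay (K₀)
open Literature.MathematicalPhysics.QuantumFieldTheory.Balaban1983to89.Node00 (Stage12Params IsDatumOfRecord₁₂C U3Letters₁₁ U3Objects₁₁ NE2Objects₁₁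
  NE3Letters₁₁ RateAssignment₁₂ prependCoupling MatA ιSU avOfRecord)
open Literature.MathematicalPhysics.QuantumFieldTheory.Balaban1983to89.Node00.Sect2 (domCount domSys CPair ofBackgroundC)
open Literature.MathematicalPhysics.QuantumFieldTheory.Balaban1983to89.Node00.W1 (ReadingData LevelPairing LetterInputs ClusterTower pairOfRecord
  dj_pairOfRecord functionalC functional termC box SpRestr AdmBg)
open Summit.QuantumFields.BalabanUV.T4Continuum.B13Carriers (transportRaw)
open Summit.QuantumFields.BalabanUV.T4Continuum.Spine.NE5
open Summit.QuantumFields.YangMills.BalabanUVNodes.N18AtByName (n18At_mono)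
open Summit.QuantumFields.YangMills.BalabanUVNodes.N18HLayerW1Induction (decayBound_EA_ofRecordAdm_of_inductiveStep decayBound_EB_ofRecordAdm_of_inductiveStep)
open YMDAG.N18.HLayer
open YMDAG.UVSplit

variable {N : ℕ} [NeZero N]

/-! ## §1 At the admissible pairing of record: the END with L05 ∕ L06 from (STEP) -/

section Pairing

variable {F : T4Family} {M k : ℕ}
  (sp : (k j : ℕ) → (domSys (F.P k) M j).Dom → Set (CPair (F.P k) (MatA N)))
  (gauge : GaugeField (F.P k) 0 (Node00.SU N) → GaugeField (F.P k) 0 (Node00.SU N) → ℝ) (hg : ∀ U U', 0 ≤ gauge U U')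
  (transport : GaugeField (F.P (k + 1)) 0 (Node00.SU N) → GaugeField (F.P k) 0 (Node00.SU N))
  (hT : ∀ U : GaugeField (F.P (k + 1)) 0 (Node00.SU N),
    (∀ (j : ℕ) (Y : (domSys (F.P (k + 1)) M j).Dom), ofBackgroundC (ιSU N) U ∈ sp (k + 1) j Y) →
      ∀ (j : ℕ) (Y : (domSys (F.P k) M j).Dom), ofBackgroundC (ιSU N) (transport U) ∈ sp k j Y)
  (S : ClusterTower (F.P k) (MatA N) M) (S' : ClusterTower (F.P (k + 1)) (MatA N) M)
variable {Op Hist : Type*} [NormedAddCommGroup Op] [NormedSpace ℂ Op] [NormedAddCommGroup Hist] [NormedSpace ℂ Hist]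

omit [NeZero N] in
open Classical in
/-- **N18 AT THE ADMISSIBLE PAIRING OF RECORD FROM THE H-LAYER END, LEVELS LEAVES FROM (STEP)** [bookkeeping; module 9 §2 `n18At_pairing_of_envelopeOnW1Carriers` at
`R := LevelPairing.ofRecordAdm F M N k sp gauge hg T₀ hT` with `l05 ∕ l06 :=` dag-n18-c g4's `decayBound_EA∕EB_ofRecordAdm_of_inductiveStep`].  Hypotheses: (i) the
END's data over the pairing's carriers (per-member step models representing (2.13) with THE NODE-A MAJORANT AS HYPOTHESIS, L01–L03, L07–L09*, the located numerals
with the levels letters `e·576·K₀(64,8)²·A_A ∕ A_B`, L10, the sharp clause); (ii) FOR EACH RUN, dag-n18-c's ONE-STEP SCHEMA (STEP) for its tower on its tables —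
(1.18) with letters `(E_A, κ)` ∕ `(E_B, κ)` and analyticity at the levels `≤ m` imply the step-`m` pair `AnalyticH ∧ Bound238` with amplitude `A_A ∕ A_B` and the
END's rate `R_d` — the tables restriction-closed, the STRICT [KP86] clauses and the renewals `e·576·K₀(64,8)²·A ≤ E`.  NO embedding clause, NO pairing clause.
[cite: Balaban1987RG1, Thm 1 p.259 and (1.18) p.263; Balaban1988RG2Cluster, (2.13) p.14, p.15, (2.16)–(2.18) p.16, Lemma 3 (2.38) p.20, (2.41) p.21 and p.22; KoteckyPreiss1986, Thm 1 p.492] -/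
theorem n18At_pairingAdm_of_inductiveStep
    (Mb : ℝ → StepModel (LevelPairing.ofRecordAdm F M N k sp gauge hg transport hT).carriers Op Hist)
    {act : ℝ → (j : ℕ) → Op × Hist → TDom 4 (domCount (F.P k) M j) → ℂ} {γ C3 ε₁ Rd κ A_A A_B E_A E_B E₁ δ δ' θ θ' cH ω ρ₀ B : ℝ} {k₀ : ℕ}
    -- (i) the END's data on the pairing's carriers
    (hrep : ∀ b : ℝ, 0 < b → b ≤ γ → ∀ (X : Node00.W1.Dom (F.P k) M) (z : Op × Hist),
      (Mb b).Out X.1 z.1 z.2 X =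
        locE (TTouch (d := 4) (N := domCount (F.P k) M X.1)) (fun Z : (tsys 4 (domCount (F.P k) M X.1)).Dom => Z.1) (act b X.1 z) X.2.1)
    (hC3 : 0 ≤ C3) (hε₁ : 0 ≤ ε₁) (hκ : 0 ≤ κ) (hrate : κ + 2 * (64 * Real.log 162) + 2 ≤ Rd)
    (hKP : C3 * ε₁ * Real.exp (5 * κ + 1) * K₀ 64 8 * 9 * 64 ≤ 1)
    (hH : ∀ b : ℝ, 0 < b → b ≤ γ → ∀ j, ∀ g ∈ Window γ, ∀ (U : (LevelPairing.ofRecordAdm F M N k sp gauge hg transport hT).BgB) (q : Op × Hist),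
      q ∈ (Mb b).Base j g U →
      ∃ V : Set (Op × Hist), IsOpen V ∧ (Mb b).box j q ⊆ V ∧
        (∀ Z : TDom 4 (domCount (F.P k) M j), DifferentiableOn ℂ (fun z : Op × Hist => act b j z Z) V) ∧
        (∀ z ∈ V, ∀ Z : TDom 4 (domCount (F.P k) M j), ‖act b j z Z‖ ≤ C3 * ε₁ * Real.exp (-(Rd * torusTreeLen Z.1))))
    (l01 : ∀ b : ℝ, 0 < b → b ≤ γ → L01 (Mb b) ((LevelPairing.ofRecordAdm F M N k sp gauge hg transport hT).EA S) (Window γ))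
    (l02 : ∀ b : ℝ, 0 < b → b ≤ γ → L02 (Mb b) ((LevelPairing.ofRecordAdm F M N k sp gauge hg transport hT).EB S' b) (Window γ))
    (l03 : ∀ b : ℝ, 0 < b → b ≤ γ → L03 (Mb b) ((LevelPairing.ofRecordAdm F M N k sp gauge hg transport hT).EB S' b) (Window γ))
    (l07 : ∀ b : ℝ, 0 < b → b ≤ γ → L07 (Mb b) (Window γ) δ θ)
    (l08 : ∀ b : ℝ, 0 < b → b ≤ γ → L08 (Mb b) (Window γ) κ (Real.exp 1 * 9 * 64 * K₀ 64 8 ^ 2 * A_B) δ' θ)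
    (l09aff : ∀ b : ℝ, 0 < b → b ≤ γ → L09aff (Mb b) (Window γ)) (l09blind : ∀ b : ℝ, 0 < b → b ≤ γ → L09blind (Mb b) (Window γ))
    (l09hom : ∀ b : ℝ, 0 < b → b ≤ γ → L09hom (Mb b) (Window γ))
    (l09unit : ∀ b : ℝ, 0 < b → b ≤ γ → L09unit (Mb b) (Window γ) κ E₁ cH ω)
    (hE₁ : 0 < E₁) (hδ : 0 ≤ δ + δ') (hθ : 0 ≤ θ) (hθθ' : θ ≤ θ') (hθ'1 : θ' ≤ 1) (hcH : 0 ≤ cH) (hω : 0 < ω) (hρ₀ : ρ₀ < 1)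
    (l10near : (δ + δ') * θ ^ k₀ +
      cH * (Real.exp 1 * 9 * 64 * K₀ 64 8 ^ 2 * A_A + Real.exp 1 * 9 * 64 * K₀ 64 8 ^ 2 * A_B) / (1 - ω) ≤ ρ₀)
    (hB : 0 ≤ B) (l10first : ∀ k < k₀, Real.exp 1 * 9 * 64 * K₀ 64 8 ^ 2 * A_A + Real.exp 1 * 9 * 64 * K₀ 64 8 ^ 2 * A_B ≤ B * θ ^ k)
    (hS : Real.exp 1 * 9 * 64 * K₀ 64 8 ^ 2 * C3 * cH * ε₁ < (θ' - ω) * (1 - ρ₀))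
    -- (ii) dag-n18-c's ONE-STEP SCHEMA (STEP) for run A's tower on the tables `sp k`
    (hrestrA : ∀ m, SpRestr (sp k (m + 1)))
    (hstepA : ∀ m : ℕ,
      (∀ g ∈ Window γ, ∀ j ≤ m, ∀ (X : (domSys (F.P k) M j).Dom), ∀ φ ∈ sp k j X,
          ‖termC S j X g φ‖ ≤ E_A * Real.exp (-(κ * (domSys (F.P k) M j).dj X))) →
      (∀ g ∈ Window γ, ∀ j ≤ m, ∀ (X : (domSys (F.P k) M j).Dom), AnalyticOnNhd ℂ (termC S j X g) (sp k j X)) →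
      (S m).AnalyticH (box γ m) (sp k (m + 1)) ∧ (S m).Bound238 (box γ m) (sp k (m + 1)) A_A Rd)
    (hAA : 0 ≤ A_A) (hsmallA : A_A * Real.exp (5 * κ + 1) * K₀ 64 8 * 9 * 64 < 1) (hrenewA : Real.exp 1 * 9 * 64 * K₀ 64 8 ^ 2 * A_A ≤ E_A)
    -- … and for run B's tower on the tables `sp (k+1)`
    (hrestrB : ∀ m, SpRestr (sp (k + 1) (m + 1)))
    (hstepB : ∀ m : ℕ,
      (∀ g ∈ Window γ, ∀ j ≤ m, ∀ (Y : (domSys (F.P (k + 1)) M j).Dom), ∀ φ ∈ sp (k + 1) j Y,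
          ‖termC S' j Y g φ‖ ≤ E_B * Real.exp (-(κ * (domSys (F.P (k + 1)) M j).dj Y))) →
      (∀ g ∈ Window γ, ∀ j ≤ m, ∀ (Y : (domSys (F.P (k + 1)) M j).Dom), AnalyticOnNhd ℂ (termC S' j Y g) (sp (k + 1) j Y)) →
      (S' m).AnalyticH (box γ m) (sp (k + 1) (m + 1)) ∧ (S' m).Bound238 (box γ m) (sp (k + 1) (m + 1)) A_B Rd)
    (hAB : 0 ≤ A_B) (hsmallB : A_B * Real.exp (5 * κ + 1) * K₀ 64 8 * 9 * 64 < 1) (hrenewB : Real.exp 1 * 9 * 64 * K₀ 64 8 ^ 2 * A_B ≤ E_B)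
    (Λ : ℕ → ℕ → ℝ) (C₉ ωm cr ρ : ℝ) :
    N18At ⟨(LevelPairing.ofRecordAdm F M N k sp gauge hg transport hT).carriers, Window γ, γ, κ,
      (LevelPairing.ofRecordAdm F M N k sp gauge hg transport hT).EA S, (LevelPairing.ofRecordAdm F M N k sp gauge hg transport hT).EB S', θ',
      (Real.exp 1 * 9 * 64 * K₀ 64 8 ^ 2 * (C3 * ε₁) / (1 - ρ₀) * (δ + δ') + B) * (θ' - ω) /
        (θ' - (ω + Real.exp 1 * 9 * 64 * K₀ 64 8 ^ 2 * (C3 * ε₁) / (1 - ρ₀) * cH)), Λ, C₉, ωm, cr, ρ⟩ :=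
  have l05 : L05 ((LevelPairing.ofRecordAdm F M N k sp gauge hg transport hT).EA S) (Window γ) (Real.exp 1 * 9 * 64 * K₀ 64 8 ^ 2 * A_A) κ :=
    decayBound_EA_ofRecordAdm_of_inductiveStep F M N k sp gauge hg transport hT S hrestrA hstepA hAA hκ hrate hsmallA hrenewA
  have l06 : ∀ b : ℝ, 0 < b → b ≤ γ →
      L06 ((LevelPairing.ofRecordAdm F M N k sp gauge hg transport hT).EB S' b) (Window γ) (Real.exp 1 * 9 * 64 * K₀ 64 8 ^ 2 * A_B) κ :=
    fun _ hb hbγ => decayBound_EB_ofRecordAdm_of_inductiveStep F M N k sp gauge hg transport hT S' hrestrB hstepB hAB hκ hrate hsmallB hrenewB ⟨hb, hbγ⟩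
  n18At_pairing_of_envelopeOnW1Carriers (LevelPairing.ofRecordAdm F M N k sp gauge hg transport hT) Mb hrep hC3 hε₁ hκ hrate hKP hH l01 l02 l03 l05 l06
    l07 l08 l09aff l09blind l09hom l09unit hE₁ hδ hθ hθθ' hθ'1 hcH hω hρ₀ l10near hB l10first hS Λ C₉ ωm cr ρ

end Pairing

/-! ## §2 The row AT THE ADMISSIBLE READING in the inductive currency -/

section Record

variable (S : (F : T4Family) → (θ : Stage12Params F N) → (k : ℕ) → ClusterTower (F.P k) (MatA N) θ.τ9.M)
  (sp : (F : T4Family) → (θ : Stage12Params F N) → (k j : ℕ) → (domSys (F.P k) θ.τ9.M j).Dom → Set (CPair (F.P k) (MatA N)))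
  (gauge : (F : T4Family) → (θ : Stage12Params F N) → (k : ℕ) → GaugeField (F.P k) 0 (Node00.SU N) → GaugeField (F.P k) 0 (Node00.SU N) → ℝ)
  (hg : ∀ (F : T4Family) (θ : Stage12Params F N) (k : ℕ) (U U' : GaugeField (F.P k) 0 (Node00.SU N)), 0 ≤ gauge F θ k U U')
  (T₀ : (F : T4Family) → (θ : Stage12Params F N) → (k : ℕ) → GaugeField (F.P (k + 1)) 0 (Node00.SU N) → GaugeField (F.P k) 0 (Node00.SU N))
  (hT : ∀ (F : T4Family) (θ : Stage12Params F N) (k : ℕ) (U : GaugeField (F.P (k + 1)) 0 (Node00.SU N)),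
    (∀ (j : ℕ) (Y : (domSys (F.P (k + 1)) θ.τ9.M j).Dom), ofBackgroundC (ιSU N) U ∈ sp F θ (k + 1) j Y) →
      ∀ (j : ℕ) (X : (domSys (F.P k) θ.τ9.M j).Dom), ofBackgroundC (ιSU N) (T₀ F θ k U) ∈ sp F θ k j X)
  (li : (F : T4Family) → Stage12Params F N → LetterInputs) (ℓ₃ : T4Family → NE3Letters₁₁)
  (ne2 : (F : T4Family) → Stage12Params F N → (ℕ → ℝ) → List (ULoop F) → ℕ → NE2Objects₁₁)
  (ne1 : (F : T4Family) → Stage12Params F N → (ℕ → ℝ) → List (ULoop F) → NE1pCarriers)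

open Classical in
/-- **THE ROW AT THE ADMISSIBLE READING WITH THE LEVELS LEAVES PRODUCED FROM (STEP)** [bookkeeping; §1 once per key and level, then `N18AtByName.n18At_mono` with module
9's `endConstant_nonneg` and module 8's bundle equation — module 12 §3's twin with dag-n18-c's ONE-STEP SCHEMA in place of unconditional `AnalyticH`∕`Bound238`].  If at
EVERY admissible Stage-12 tuple with provisos and every run length there are (i) the END's data over the carriers of the admissible pairing and (ii) (STEP) for both
runs' towers of record on the tables `sp F θ k` ∕ `sp F θ (k+1)` (restriction-closed), the STRICT clauses and the renewals, the letters `li F θ` dominating — then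
`S_N18 (RRec₁₂ 𝔯_adm)`. [cite: Balaban1987RG1, (0.24)–(0.25) p.257, Thm 1 p.259 and (1.18) p.263; Balaban1988RG2Cluster, (2.13) p.14, p.15, (2.16)–(2.18) p.16, Lemma 3 (2.38) p.20 and p.22] -/
theorem s_N18_readingAdm₁₂_of_inductiveStep
    (h : ∀ (F : T4Family) (θ : Stage12Params F N), θ.Provisos₁₂ F N → θ.Admissible F N → ∀ k : ℕ,
      ∃ (Op : Type) (_ : NormedAddCommGroup Op) (_ : NormedSpace ℂ Op) (Hist : Type) (_ : NormedAddCommGroup Hist) (_ : NormedSpace ℂ Hist)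
        (Mb : ℝ → StepModel (LevelPairing.ofRecordAdm F θ.τ9.M N k (sp F θ) (gauge F θ k) (hg F θ k) (T₀ F θ k) (hT F θ k)).carriers Op Hist)
        (act : ℝ → (j : ℕ) → Op × Hist → TDom 4 (domCount (F.P k) θ.τ9.M j) → ℂ) (γ' C3 ε₁ Rd κ A_A A_B E_A E_B E₁ δ δ' θr θ' cH ω ρ₀ B : ℝ)
        (k₀ : ℕ),
        -- (i) the END's data over the carriers of the admissible level pairing
        (∀ b : ℝ, 0 < b → b ≤ γ' → ∀ (X : Node00.W1.Dom (F.P k) θ.τ9.M) (z : Op × Hist),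
          (Mb b).Out X.1 z.1 z.2 X =
            locE (TTouch (d := 4) (N := domCount (F.P k) θ.τ9.M X.1)) (fun Z : (tsys 4 (domCount (F.P k) θ.τ9.M X.1)).Dom => Z.1)
              (act b X.1 z) X.2.1) ∧
        0 ≤ C3 ∧ 0 ≤ ε₁ ∧ 0 ≤ κ ∧ κ + 2 * (64 * Real.log 162) + 2 ≤ Rd ∧
        C3 * ε₁ * Real.exp (5 * κ + 1) * K₀ 64 8 * 9 * 64 ≤ 1 ∧
        (∀ b : ℝ, 0 < b → b ≤ γ' → ∀ j, ∀ g ∈ Window γ',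
          ∀ (U : (LevelPairing.ofRecordAdm F θ.τ9.M N k (sp F θ) (gauge F θ k) (hg F θ k) (T₀ F θ k) (hT F θ k)).BgB) (q : Op × Hist),
          q ∈ (Mb b).Base j g U →
          ∃ V : Set (Op × Hist), IsOpen V ∧ (Mb b).box j q ⊆ V ∧
            (∀ Z : TDom 4 (domCount (F.P k) θ.τ9.M j), DifferentiableOn ℂ (fun z : Op × Hist => act b j z Z) V) ∧
            (∀ z ∈ V, ∀ Z : TDom 4 (domCount (F.P k) θ.τ9.M j), ‖act b j z Z‖ ≤ C3 * ε₁ * Real.exp (-(Rd * torusTreeLen Z.1)))) ∧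
        (∀ b : ℝ, 0 < b → b ≤ γ' → L01 (Mb b)
          ((LevelPairing.ofRecordAdm F θ.τ9.M N k (sp F θ) (gauge F θ k) (hg F θ k) (T₀ F θ k) (hT F θ k)).EA (S F θ k)) (Window γ')) ∧
        (∀ b : ℝ, 0 < b → b ≤ γ' → L02 (Mb b)
          ((LevelPairing.ofRecordAdm F θ.τ9.M N k (sp F θ) (gauge F θ k) (hg F θ k) (T₀ F θ k) (hT F θ k)).EB (S F θ (k + 1)) b)
          (Window γ')) ∧
        (∀ b : ℝ, 0 < b → b ≤ γ' → L03 (Mb b)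
          ((LevelPairing.ofRecordAdm F θ.τ9.M N k (sp F θ) (gauge F θ k) (hg F θ k) (T₀ F θ k) (hT F θ k)).EB (S F θ (k + 1)) b)
          (Window γ')) ∧
        (∀ b : ℝ, 0 < b → b ≤ γ' → L07 (Mb b) (Window γ') δ θr) ∧
        (∀ b : ℝ, 0 < b → b ≤ γ' → L08 (Mb b) (Window γ') κ (Real.exp 1 * 9 * 64 * K₀ 64 8 ^ 2 * A_B) δ' θr) ∧
        (∀ b : ℝ, 0 < b → b ≤ γ' → L09aff (Mb b) (Window γ')) ∧ (∀ b : ℝ, 0 < b → b ≤ γ' → L09blind (Mb b) (Window γ')) ∧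
        (∀ b : ℝ, 0 < b → b ≤ γ' → L09hom (Mb b) (Window γ')) ∧ (∀ b : ℝ, 0 < b → b ≤ γ' → L09unit (Mb b) (Window γ') κ E₁ cH ω) ∧
        0 < E₁ ∧ 0 ≤ δ + δ' ∧ 0 ≤ θr ∧ θr ≤ θ' ∧ θ' ≤ 1 ∧ 0 ≤ cH ∧ 0 < ω ∧ ρ₀ < 1 ∧
        (δ + δ') * θr ^ k₀ +
            cH * (Real.exp 1 * 9 * 64 * K₀ 64 8 ^ 2 * A_A + Real.exp 1 * 9 * 64 * K₀ 64 8 ^ 2 * A_B) / (1 - ω) ≤ ρ₀ ∧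
        0 ≤ B ∧ (∀ k < k₀, Real.exp 1 * 9 * 64 * K₀ 64 8 ^ 2 * A_A + Real.exp 1 * 9 * 64 * K₀ 64 8 ^ 2 * A_B ≤ B * θr ^ k) ∧
        Real.exp 1 * 9 * 64 * K₀ 64 8 ^ 2 * C3 * cH * ε₁ < (θ' - ω) * (1 - ρ₀) ∧
        -- (ii) (STEP) for both runs' towers on the tables `sp F θ k` ∕ `sp F θ (k+1)`, restriction-closedness, STRICT clauses, renewals
        (∀ m, SpRestr (sp F θ k (m + 1))) ∧
        (∀ m : ℕ,
          (∀ g ∈ Window γ', ∀ j ≤ m, ∀ (X : (domSys (F.P k) θ.τ9.M j).Dom), ∀ φ ∈ sp F θ k j X,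
              ‖termC (S F θ k) j X g φ‖ ≤ E_A * Real.exp (-(κ * (domSys (F.P k) θ.τ9.M j).dj X))) →
          (∀ g ∈ Window γ', ∀ j ≤ m, ∀ (X : (domSys (F.P k) θ.τ9.M j).Dom), AnalyticOnNhd ℂ (termC (S F θ k) j X g) (sp F θ k j X)) →
          (S F θ k m).AnalyticH (box γ' m) (sp F θ k (m + 1)) ∧ (S F θ k m).Bound238 (box γ' m) (sp F θ k (m + 1)) A_A Rd) ∧
        0 ≤ A_A ∧ A_A * Real.exp (5 * κ + 1) * K₀ 64 8 * 9 * 64 < 1 ∧ Real.exp 1 * 9 * 64 * K₀ 64 8 ^ 2 * A_A ≤ E_A ∧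
        (∀ m, SpRestr (sp F θ (k + 1) (m + 1))) ∧
        (∀ m : ℕ,
          (∀ g ∈ Window γ', ∀ j ≤ m, ∀ (Y : (domSys (F.P (k + 1)) θ.τ9.M j).Dom), ∀ φ ∈ sp F θ (k + 1) j Y,
              ‖termC (S F θ (k + 1)) j Y g φ‖ ≤ E_B * Real.exp (-(κ * (domSys (F.P (k + 1)) θ.τ9.M j).dj Y))) →
          (∀ g ∈ Window γ', ∀ j ≤ m, ∀ (Y : (domSys (F.P (k + 1)) θ.τ9.M j).Dom),
              AnalyticOnNhd ℂ (termC (S F θ (k + 1)) j Y g) (sp F θ (k + 1) j Y)) →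
          (S F θ (k + 1) m).AnalyticH (box γ' m) (sp F θ (k + 1) (m + 1)) ∧ (S F θ (k + 1) m).Bound238 (box γ' m) (sp F θ (k + 1) (m + 1)) A_B Rd) ∧
        0 ≤ A_B ∧ A_B * Real.exp (5 * κ + 1) * K₀ 64 8 * 9 * 64 < 1 ∧ Real.exp 1 * 9 * 64 * K₀ 64 8 ^ 2 * A_B ≤ E_B ∧
        -- the reading's letters dominate the END's
        θ.γ ≤ γ' ∧ (li F θ).κ ≤ κ ∧ θ' ≤ (li F θ).θ₅ ∧
        (Real.exp 1 * 9 * 64 * K₀ 64 8 ^ 2 * (C3 * ε₁) / (1 - ρ₀) * (δ + δ') + B) * (θ' - ω) /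
            (θ' - (ω + Real.exp 1 * 9 * 64 * K₀ 64 8 ^ 2 * (C3 * ε₁) / (1 - ρ₀) * cH)) ≤ (li F θ).C₅) :
    S_N18 (RRec₁₂ (readingOfRecord₁₂ (fun F θ => ReadingData.ofRecordAdm F θ.τ9.M N (S F θ) (sp F θ) (gauge F θ) (hg F θ) (T₀ F θ) (hT F θ) (li F θ))
      ℓ₃ ne2 ne1)) := by
  refine s_N18_rRec₁₂_of_forall_admissible _ fun F θ hP hA g₀ os k => ?_
  obtain ⟨Op, _, _, Hist, _, _, Mb, act, γ', C3, ε₁, Rd, κ, A_A, A_B, E_A, E_B, E₁, δ, δ', θr, θ', cH, ω, ρ₀, B, k₀, hrep, hC3, hε₁, hκ, hrate, hKP,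
    hH, l01, l02, l03, l07, l08, l09aff, l09blind, l09hom, l09unit, hE₁, hδ, hθ, hθθ', hθ'1, hcH, hω, hρ₀, l10near, hB, l10first, hS, hrestrA, hstepA,
    hAA, hsmallA, hrenewA, hrestrB, hstepB, hAB, hsmallB, hrenewB, hγ, hℓκ, hℓθ, hℓC⟩ := h F θ hP hA k
  have hN := n18At_pairingAdm_of_inductiveStep (sp F θ) (gauge F θ k) (hg F θ k) (T₀ F θ k) (hT F θ k) (S F θ k) (S F θ (k + 1)) Mb hrep hC3 hε₁ hκ
    hrate hKP hH l01 l02 l03 l07 l08 l09aff l09blind l09hom l09unit hE₁ hδ hθ hθθ' hθ'1 hcH hω hρ₀ l10near hB l10first hS hrestrA hstepA hAA hsmallA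
    hrenewA hrestrB hstepB hAB hsmallB hrenewB ((li F θ).analytic θ.γ).moduli ((li F θ).analytic θ.γ).C₉ ((li F θ).analytic θ.γ).ω (li F θ).cr (li F θ).ρ
  have hW : Window θ.γ ⊆ Window γ' := fun g hgW i => ⟨(hgW i).1, (hgW i).2.trans hγ⟩
  exact (n18At_u3OfRecord₁₂_w1_iff_pairing (pinnedInputs₁₂ (fun F θ => ReadingData.ofRecordAdm F θ.τ9.M N (S F θ) (sp F θ) (gauge F θ) (hg F θ) (T₀ F θ)
      (hT F θ) (li F θ)) ℓ₃ ne2) F θ g₀ os k).2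
    (n18At_mono hN hW hγ hℓκ (hθ.trans hθθ') hℓθ (endConstant_nonneg hC3 hε₁ hδ hcH hρ₀ hB hS) hℓC)

end Record

/-! ## §3 The same on the PLAQUETTE-SMALL tables with the transport of record -/

section PlaqSmall

variable (S : (F : T4Family) → (θ : Stage12Params F N) → (k : ℕ) → ClusterTower (F.P k) (MatA N) θ.τ9.M)
  (a : (F : T4Family) → Stage12Params F N → ℕ → ℝ)
  (hT : ∀ (F : T4Family) (θ : Stage12Params F N) (k : ℕ) (U : GaugeField (F.P (k + 1)) 0 (Node00.SU N)),
    (∀ (j : ℕ) (Y : (domSys (F.P (k + 1)) θ.τ9.M j).Dom),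
      ofBackgroundC (ιSU N) U ∈ (fun (k j : ℕ) (_ : (domSys (F.P k) θ.τ9.M j).Dom) =>
        ofBackgroundC (ιSU N) '' {V : GaugeField (F.P k) 0 (Node00.SU N) | PlaqSmall (a F θ k) V}) (k + 1) j Y) →
      ∀ (j : ℕ) (X : (domSys (F.P k) θ.τ9.M j).Dom),
        ofBackgroundC (ιSU N) (transportRaw F k (avOfRecord F N (k + 1) 0) U) ∈
          (fun (k j : ℕ) (_ : (domSys (F.P k) θ.τ9.M j).Dom) =>
            ofBackgroundC (ιSU N) '' {V : GaugeField (F.P k) 0 (Node00.SU N) | PlaqSmall (a F θ k) V}) k j X)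
  (gauge : (F : T4Family) → (θ : Stage12Params F N) → (k : ℕ) → GaugeField (F.P k) 0 (Node00.SU N) → GaugeField (F.P k) 0 (Node00.SU N) → ℝ)
  (hg : ∀ (F : T4Family) (θ : Stage12Params F N) (k : ℕ) (U U' : GaugeField (F.P k) 0 (Node00.SU N)), 0 ≤ gauge F θ k U U')
  (li : (F : T4Family) → Stage12Params F N → LetterInputs) (ℓ₃ : T4Family → NE3Letters₁₁)
  (ne2 : (F : T4Family) → Stage12Params F N → (ℕ → ℝ) → List (ULoop F) → ℕ → NE2Objects₁₁)
  (ne1 : (F : T4Family) → Stage12Params F N → (ℕ → ℝ) → List (ULoop F) → NE1pCarriers)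

open Classical in
/-- **THE ROW AT THE ε-SMALL FIELDS IN THE INDUCTIVE CURRENCY** [bookkeeping; §2 at the plaquette-small tables of module 13 with the transport of record: the
restriction clauses `SpRestr` are TRIVIAL (constant tables) and the transport clause `hT` is ANY proof — module 13 §4's `admTransport_plaqSmall` ∕ `_sharp`].
END data over the admissible carriers + (STEP) for both runs' towers ON THE PLAQUETTE-SMALL TABLES ((1.18) at the ε-small fields + analyticity there at levels
`≤ m` ⟹ the step-`m` pair there) + STRICT clauses + renewals, letters dominating ⟹ `S_N18` at the admissible reading on the plaquette-small tables.
[cite: Balaban1987RG1, (0.18) p.255, (0.24)–(0.25) p.257, Thm 1 p.259 and (1.18) p.263; Balaban1988RG2Cluster, (2.13) p.14, p.15, Lemma 3 (2.38) p.20 and p.22; Balaban1985Averaging, Prop. 1 (51) p.26] -/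
theorem s_N18_readingAdmPlaqSmall₁₂_of_inductiveStep
    (h : ∀ (F : T4Family) (θ : Stage12Params F N), θ.Provisos₁₂ F N → θ.Admissible F N → ∀ k : ℕ,
      ∃ (Op : Type) (_ : NormedAddCommGroup Op) (_ : NormedSpace ℂ Op) (Hist : Type) (_ : NormedAddCommGroup Hist) (_ : NormedSpace ℂ Hist)
        (Mb : ℝ → StepModel (LevelPairing.ofRecordAdm F θ.τ9.M N k (fun (k j : ℕ) (_ : (domSys (F.P k) θ.τ9.M j).Dom) =>
            ofBackgroundC (ιSU N) '' {V : GaugeField (F.P k) 0 (Node00.SU N) | PlaqSmall (a F θ k) V})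
          (gauge F θ k) (hg F θ k) (transportRaw F k (avOfRecord F N (k + 1) 0)) (hT F θ k)).carriers Op Hist)
        (act : ℝ → (j : ℕ) → Op × Hist → TDom 4 (domCount (F.P k) θ.τ9.M j) → ℂ) (γ' C3 ε₁ Rd κ A_A A_B E_A E_B E₁ δ δ' θr θ' cH ω ρ₀ B : ℝ)
        (k₀ : ℕ),
        -- (i) the END's data over the carriers of the admissible level pairing
        (∀ b : ℝ, 0 < b → b ≤ γ' → ∀ (X : Node00.W1.Dom (F.P k) θ.τ9.M) (z : Op × Hist),
          (Mb b).Out X.1 z.1 z.2 X =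
            locE (TTouch (d := 4) (N := domCount (F.P k) θ.τ9.M X.1)) (fun Z : (tsys 4 (domCount (F.P k) θ.τ9.M X.1)).Dom => Z.1)
              (act b X.1 z) X.2.1) ∧
        0 ≤ C3 ∧ 0 ≤ ε₁ ∧ 0 ≤ κ ∧ κ + 2 * (64 * Real.log 162) + 2 ≤ Rd ∧
        C3 * ε₁ * Real.exp (5 * κ + 1) * K₀ 64 8 * 9 * 64 ≤ 1 ∧
        (∀ b : ℝ, 0 < b → b ≤ γ' → ∀ j, ∀ g ∈ Window γ',
          ∀ (U : (LevelPairing.ofRecordAdm F θ.τ9.M N k (fun (k j : ℕ) (_ : (domSys (F.P k) θ.τ9.M j).Dom) =>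
            ofBackgroundC (ιSU N) '' {V : GaugeField (F.P k) 0 (Node00.SU N) | PlaqSmall (a F θ k) V})
          (gauge F θ k) (hg F θ k) (transportRaw F k (avOfRecord F N (k + 1) 0)) (hT F θ k)).BgB) (q : Op × Hist),
          q ∈ (Mb b).Base j g U →
          ∃ V : Set (Op × Hist), IsOpen V ∧ (Mb b).box j q ⊆ V ∧
            (∀ Z : TDom 4 (domCount (F.P k) θ.τ9.M j), DifferentiableOn ℂ (fun z : Op × Hist => act b j z Z) V) ∧
            (∀ z ∈ V, ∀ Z : TDom 4 (domCount (F.P k) θ.τ9.M j), ‖act b j z Z‖ ≤ C3 * ε₁ * Real.exp (-(Rd * torusTreeLen Z.1)))) ∧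
        (∀ b : ℝ, 0 < b → b ≤ γ' → L01 (Mb b)
          ((LevelPairing.ofRecordAdm F θ.τ9.M N k (fun (k j : ℕ) (_ : (domSys (F.P k) θ.τ9.M j).Dom) =>
            ofBackgroundC (ιSU N) '' {V : GaugeField (F.P k) 0 (Node00.SU N) | PlaqSmall (a F θ k) V})
          (gauge F θ k) (hg F θ k) (transportRaw F k (avOfRecord F N (k + 1) 0)) (hT F θ k)).EA (S F θ k)) (Window γ')) ∧
        (∀ b : ℝ, 0 < b → b ≤ γ' → L02 (Mb b)
          ((LevelPairing.ofRecordAdm F θ.τ9.M N k (fun (k j : ℕ) (_ : (domSys (F.P k) θ.τ9.M j).Dom) =>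
            ofBackgroundC (ιSU N) '' {V : GaugeField (F.P k) 0 (Node00.SU N) | PlaqSmall (a F θ k) V})
          (gauge F θ k) (hg F θ k) (transportRaw F k (avOfRecord F N (k + 1) 0)) (hT F θ k)).EB (S F θ (k + 1)) b)
          (Window γ')) ∧
        (∀ b : ℝ, 0 < b → b ≤ γ' → L03 (Mb b)
          ((LevelPairing.ofRecordAdm F θ.τ9.M N k (fun (k j : ℕ) (_ : (domSys (F.P k) θ.τ9.M j).Dom) =>
            ofBackgroundC (ιSU N) '' {V : GaugeField (F.P k) 0 (Node00.SU N) | PlaqSmall (a F θ k) V})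
          (gauge F θ k) (hg F θ k) (transportRaw F k (avOfRecord F N (k + 1) 0)) (hT F θ k)).EB (S F θ (k + 1)) b)
          (Window γ')) ∧
        (∀ b : ℝ, 0 < b → b ≤ γ' → L07 (Mb b) (Window γ') δ θr) ∧
        (∀ b : ℝ, 0 < b → b ≤ γ' → L08 (Mb b) (Window γ') κ (Real.exp 1 * 9 * 64 * K₀ 64 8 ^ 2 * A_B) δ' θr) ∧
        (∀ b : ℝ, 0 < b → b ≤ γ' → L09aff (Mb b) (Window γ')) ∧ (∀ b : ℝ, 0 < b → b ≤ γ' → L09blind (Mb b) (Window γ')) ∧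
        (∀ b : ℝ, 0 < b → b ≤ γ' → L09hom (Mb b) (Window γ')) ∧ (∀ b : ℝ, 0 < b → b ≤ γ' → L09unit (Mb b) (Window γ') κ E₁ cH ω) ∧
        0 < E₁ ∧ 0 ≤ δ + δ' ∧ 0 ≤ θr ∧ θr ≤ θ' ∧ θ' ≤ 1 ∧ 0 ≤ cH ∧ 0 < ω ∧ ρ₀ < 1 ∧
        (δ + δ') * θr ^ k₀ +
            cH * (Real.exp 1 * 9 * 64 * K₀ 64 8 ^ 2 * A_A + Real.exp 1 * 9 * 64 * K₀ 64 8 ^ 2 * A_B) / (1 - ω) ≤ ρ₀ ∧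
        0 ≤ B ∧ (∀ k < k₀, Real.exp 1 * 9 * 64 * K₀ 64 8 ^ 2 * A_A + Real.exp 1 * 9 * 64 * K₀ 64 8 ^ 2 * A_B ≤ B * θr ^ k) ∧
        Real.exp 1 * 9 * 64 * K₀ 64 8 ^ 2 * C3 * cH * ε₁ < (θ' - ω) * (1 - ρ₀) ∧
        -- (ii) (STEP) for both runs' towers ON THE PLAQUETTE-SMALL TABLES (constant in `(j, Y)`), STRICT clauses, renewals
        (∀ m : ℕ,
          (∀ g ∈ Window γ', ∀ j ≤ m, ∀ (X : (domSys (F.P k) θ.τ9.M j).Dom), ∀ φ ∈ (ofBackgroundC (ιSU N) '' {V : GaugeField (F.P k) 0 (Node00.SU N) | PlaqSmall (a F θ k) V}),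
              ‖termC (S F θ k) j X g φ‖ ≤ E_A * Real.exp (-(κ * (domSys (F.P k) θ.τ9.M j).dj X))) →
          (∀ g ∈ Window γ', ∀ j ≤ m, ∀ (X : (domSys (F.P k) θ.τ9.M j).Dom), AnalyticOnNhd ℂ (termC (S F θ k) j X g)
            (ofBackgroundC (ιSU N) '' {V : GaugeField (F.P k) 0 (Node00.SU N) | PlaqSmall (a F θ k) V})) →
          (S F θ k m).AnalyticH (box γ' m)
            (fun _ : (domSys (F.P k) θ.τ9.M (m + 1)).Dom =>
            ofBackgroundC (ιSU N) '' {V : GaugeField (F.P k) 0 (Node00.SU N) | PlaqSmall (a F θ k) V}) ∧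
          (S F θ k m).Bound238 (box γ' m)
            (fun _ : (domSys (F.P k) θ.τ9.M (m + 1)).Dom =>
            ofBackgroundC (ιSU N) '' {V : GaugeField (F.P k) 0 (Node00.SU N) | PlaqSmall (a F θ k) V}) A_A Rd) ∧
        0 ≤ A_A ∧ A_A * Real.exp (5 * κ + 1) * K₀ 64 8 * 9 * 64 < 1 ∧ Real.exp 1 * 9 * 64 * K₀ 64 8 ^ 2 * A_A ≤ E_A ∧
        (∀ m : ℕ,
          (∀ g ∈ Window γ', ∀ j ≤ m, ∀ (Y : (domSys (F.P (k + 1)) θ.τ9.M j).Dom), ∀ φ ∈ (ofBackgroundC (ιSU N) '' {V : GaugeField (F.P (k + 1)) 0 (Node00.SU N) | PlaqSmall (a F θ (k + 1)) V}),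
              ‖termC (S F θ (k + 1)) j Y g φ‖ ≤ E_B * Real.exp (-(κ * (domSys (F.P (k + 1)) θ.τ9.M j).dj Y))) →
          (∀ g ∈ Window γ', ∀ j ≤ m, ∀ (Y : (domSys (F.P (k + 1)) θ.τ9.M j).Dom),
              AnalyticOnNhd ℂ (termC (S F θ (k + 1)) j Y g)
              (ofBackgroundC (ιSU N) '' {V : GaugeField (F.P (k + 1)) 0 (Node00.SU N) | PlaqSmall (a F θ (k + 1)) V})) →
          (S F θ (k + 1) m).AnalyticH (box γ' m)
            (fun _ : (domSys (F.P (k + 1)) θ.τ9.M (m + 1)).Dom =>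
            ofBackgroundC (ιSU N) '' {V : GaugeField (F.P (k + 1)) 0 (Node00.SU N) | PlaqSmall (a F θ (k + 1)) V}) ∧
          (S F θ (k + 1) m).Bound238 (box γ' m)
            (fun _ : (domSys (F.P (k + 1)) θ.τ9.M (m + 1)).Dom =>
            ofBackgroundC (ιSU N) '' {V : GaugeField (F.P (k + 1)) 0 (Node00.SU N) | PlaqSmall (a F θ (k + 1)) V}) A_B Rd) ∧
        0 ≤ A_B ∧ A_B * Real.exp (5 * κ + 1) * K₀ 64 8 * 9 * 64 < 1 ∧ Real.exp 1 * 9 * 64 * K₀ 64 8 ^ 2 * A_B ≤ E_B ∧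
        -- the reading's letters dominate the END's
        θ.γ ≤ γ' ∧ (li F θ).κ ≤ κ ∧ θ' ≤ (li F θ).θ₅ ∧
        (Real.exp 1 * 9 * 64 * K₀ 64 8 ^ 2 * (C3 * ε₁) / (1 - ρ₀) * (δ + δ') + B) * (θ' - ω) /
            (θ' - (ω + Real.exp 1 * 9 * 64 * K₀ 64 8 ^ 2 * (C3 * ε₁) / (1 - ρ₀) * cH)) ≤ (li F θ).C₅) :
    S_N18 (RRec₁₂ (readingOfRecord₁₂ (fun F θ => ReadingData.ofRecordAdm F θ.τ9.M N (S F θ)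
      (fun (k j : ℕ) (_ : (domSys (F.P k) θ.τ9.M j).Dom) => ofBackgroundC (ιSU N) '' {V : GaugeField (F.P k) 0 (Node00.SU N) | PlaqSmall (a F θ k) V})
      (gauge F θ) (hg F θ) (fun k => transportRaw F k (avOfRecord F N (k + 1) 0)) (hT F θ) (li F θ)) ℓ₃ ne2 ne1)) := by
  refine s_N18_readingAdm₁₂_of_inductiveStep S _ gauge hg (fun F _ k => transportRaw F k (avOfRecord F N (k + 1) 0)) hT li ℓ₃ ne2 ne1
    fun F θ hP hA k => ?_
  obtain ⟨Op, iO₁, iO₂, Hist, iH₁, iH₂, Mb, act, γ', C3, ε₁, Rd, κ, A_A, A_B, E_A, E_B, E₁, δ, δ', θr, θ', cH, ω, ρ₀, B, k₀, hrep, hC3, hε₁, hκ, hrate,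
    hKP, hH, l01, l02, l03, l07, l08, l09aff, l09blind, l09hom, l09unit, hE₁, hδ, hθ, hθθ', hθ'1, hcH, hω, hρ₀, l10near, hB, l10first, hS, hstepA, hAA,
    hsmallA, hrenewA, hstepB, hAB, hsmallB, hrenewB, hγ, hℓκ, hℓθ, hℓC⟩ := h F θ hP hA k
  exact ⟨Op, iO₁, iO₂, Hist, iH₁, iH₂, Mb, act, γ', C3, ε₁, Rd, κ, A_A, A_B, E_A, E_B, E₁, δ, δ', θr, θ', cH, ω, ρ₀, B, k₀, hrep, hC3, hε₁, hκ, hrate,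
    hKP, hH, l01, l02, l03, l07, l08, l09aff, l09blind, l09hom, l09unit, hE₁, hδ, hθ, hθθ', hθ'1, hcH, hω, hρ₀, l10near, hB, l10first, hS,
    fun _ _ _ _ => Subset.rfl, hstepA, hAA, hsmallA, hrenewA, fun _ _ _ _ => Subset.rfl, hstepB, hAB, hsmallB, hrenewB, hγ, hℓκ, hℓθ, hℓC⟩

end PlaqSmall

end YMDAG.N18.W1Reading

end
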